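import Mathlib

/-!
# Lemma X — a hypothesis-free replacement for Bugeaud–Laurent's Lemme 10

Context (solo-ABC-informed report, paper §2.3, claim C14/C17).  In
Y. Bugeaud, M. Laurent, *Minoration effective de la distance `p`-adique entre puissances de
nombres algébriques*, J. Number Theory **61** (1996) 311–342, the Liouville step (Lemme 11) of
Théorème 1 needs, for the exponents `ℓ_ν = ⌊(ν-1)/K⌋` (`ν = 1, …, N = KL`) and ANY admissible
choice of integers `r_ν ∈ [0, R-1]`, a two-sided bound `M₁ - G₁ ≤ ∑ ℓ_ν r_ν ≤ M₁ + G₁` with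
`M₁ = (L-1)/2 · ∑ r_ν`; the constant `γ₁ = 4 G₁/(N L R)` then multiplies the height `h(α₁)` in
the main hypothesis.  Their Lemme 10 gives `G₁ = NL(R+g-1)/8 - gN²L/(24(S+g-1))` using that the
`r_ν` are constrained modulo `g` (K. C. Chim's thesis, TU Graz 2018, Lemma 3.13, is the same bound
in Gouillon's format).  When the multiplicative group `⟨α₁, α₂ mod p⟩` has order `g > R` — the
regime of auxiliary numbers of height far below `log p` — that `G₁` exceeds the following TRIVIAL
bound, valid with no arithmetic hypothesis at all:

  `|∑_{ν<KL} ⌊ν/K⌋ r_ν - (L-1)/2 · ∑ r_ν| ≤ K L · L · (R-1) / 8`,   i.e. `γ₁ = (R-1)/(2R) < 1/2`.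

Proof: `∑ (ℓ_ν - (L-1)/2)(r_ν - (R-1)/2)` equals the left side because `∑_ν (ℓ_ν - (L-1)/2) = 0`,
and `∑_ν |ℓ_ν - (L-1)/2| = K ∑_{ℓ<L} |ℓ - (L-1)/2| ≤ K L²/4`.
(We index `ν` from `0`, so BL's `⌊(ν-1)/K⌋`, `ν = 1..N`, is our `ν / K`, `ν = 0..N-1`.)

This is bookkeeping, not new mathematics; it is recorded in the kernel because the report's
"Theorem B" (Bugeaud–Laurent's Théorème 1 over `ℚ_p` with `γ = 1/2` and heights `≥ log 2`
allowed, hence `W(p) ≤ 100·|⟨2,y⟩|·h(y)h(2y)/(log p)² + 254`) rests on exactly this replacement.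
-/

namespace Summit.ABC.ABC.Theorems

open Finset

/-- Block sums: on `[0, K L)` the map `ν ↦ ν / K` takes each value `ℓ < L` exactly `K` times. -/
theorem soloInformed_sum_range_mul_div {M : Type*} [AddCommMonoid M] (K L : ℕ) (f : ℕ → M) :
    ∑ ν ∈ range (K * L), f (ν / K) = K • ∑ ℓ ∈ range L, f ℓ := by
  rcases Nat.eq_zero_or_pos K with hK | hK
  · subst hK; simp
  induction L with
  | zero => simp
  | succ L ih =>
    rw [Nat.mul_succ, sum_range_add, ih, sum_range_succ, smul_add]
    congr 1
    have : ∀ x ∈ range K, f ((K * L + x) / K) = f L := by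
      intro x hx
      rw [Nat.mul_add_div hK, Nat.div_eq_of_lt (mem_range.mp hx), add_zero]
    rw [sum_congr rfl this, sum_const, card_range]

/-- `∑_{ℓ<L} (2ℓ - (L-1)) = 0`. -/
theorem soloInformed_sum_two_mul_sub_eq_zero (L : ℕ) :
    ∑ ℓ ∈ range L, (2 * (ℓ : ℤ) - ((L : ℤ) - 1)) = 0 := by
  induction L with
  | zero => simp
  | succ L ih =>
    rw [sum_range_succ]
    rw [sum_sub_distrib] at ih ⊢
    simp only [sum_const, card_range, nsmul_eq_mul] at ih ⊢
    push_cast at ih ⊢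
    linear_combination ih

/-- `2 ∑_{ℓ<L} |2ℓ - (L-1)| ≤ L²` (equality for even `L`, `L² - 1` for odd `L`). -/
theorem soloInformed_two_mul_sum_abs_le_sq (L : ℕ) :
    2 * ∑ ℓ ∈ range L, |2 * (ℓ : ℤ) - ((L : ℤ) - 1)| ≤ (L : ℤ) ^ 2 := by
  induction L using Nat.strong_induction_on with
  | _ L ih =>
    rcases Nat.lt_or_ge L 2 with hL | hL
    · interval_cases L <;> simp
    · obtain ⟨L, rfl⟩ : ∃ L', L = L' + 2 := ⟨L - 2, by omega⟩
      have ih' := ih L (by omega)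
      rw [sum_range_succ', sum_range_succ]
      have key : ∀ i ∈ range L,
          |2 * ((i + 1 : ℕ) : ℤ) - (((L + 2 : ℕ) : ℤ) - 1)| = |2 * (i : ℤ) - ((L : ℤ) - 1)| := by
        intro i _
        congr 1
        push_cast
        ring
      have h1 : |2 * ((L + 1 : ℕ) : ℤ) - (((L + 2 : ℕ) : ℤ) - 1)| = (L : ℤ) + 1 := by
        rw [abs_of_nonneg (by push_cast; linarith)]
        push_cast
        ring
      have h0 : |2 * ((0 : ℕ) : ℤ) - (((L + 2 : ℕ) : ℤ) - 1)| = (L : ℤ) + 1 := by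
        rw [abs_of_nonpos (by push_cast; linarith)]
        push_cast
        ring
      rw [sum_congr rfl key, h1, h0]
      push_cast
      nlinarith [ih']

/-- **Lemma X** (integer form).  For ANY `r : ℕ → ℕ` with `r ν ≤ R - 1` on `[0, KL)`:
`|8 ∑_{ν<KL} ⌊ν/K⌋ r_ν - 4 (L-1) ∑_{ν<KL} r_ν| ≤ (R-1) K L²`. -/
theorem soloInformed_lemmaX_int (K L R : ℕ) (r : ℕ → ℕ) (hr : ∀ ν < K * L, r ν < R) :
    |8 * ∑ ν ∈ range (K * L), ((ν / K : ℕ) : ℤ) * (r ν : ℤ)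
        - 4 * ((L : ℤ) - 1) * ∑ ν ∈ range (K * L), (r ν : ℤ)|
      ≤ ((R : ℤ) - 1) * K * (L : ℤ) ^ 2 := by
  rcases Nat.eq_zero_or_pos (K * L) with h0 | hpos
  · rw [h0]
    rcases Nat.mul_eq_zero.mp h0 with hK | hL
    · subst hK; simp
    · subst hL; simp
  have hR : (1 : ℤ) ≤ R := by
    have := hr 0 hpos
    exact_mod_cast Nat.one_le_iff_ne_zero.mpr (by omega)
  -- centred variables
  set a : ℕ → ℤ := fun ν => 2 * ((ν / K : ℕ) : ℤ) - ((L : ℤ) - 1) with ha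
  set b : ℕ → ℤ := fun ν => 2 * (r ν : ℤ) - ((R : ℤ) - 1) with hb
  have hsum_a : ∑ ν ∈ range (K * L), a ν = 0 := by
    have h := soloInformed_sum_range_mul_div K L (fun ℓ => 2 * (ℓ : ℤ) - ((L : ℤ) - 1))
    simp only [ha]
    rw [h, soloInformed_sum_two_mul_sub_eq_zero, smul_zero]
  have habs_a : 2 * ∑ ν ∈ range (K * L), |a ν| ≤ K * (L : ℤ) ^ 2 := by
    have h := soloInformed_sum_range_mul_div K L (fun ℓ => |2 * (ℓ : ℤ) - ((L : ℤ) - 1)|)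
    simp only [ha]
    rw [h, nsmul_eq_mul]
    have h2 := soloInformed_two_mul_sum_abs_le_sq L
    have hK : (0 : ℤ) ≤ K := by positivity
    nlinarith [h2, hK]
  have habs_b : ∀ ν ∈ range (K * L), |b ν| ≤ (R : ℤ) - 1 := by
    intro ν hν
    have h := hr ν (mem_range.mp hν)
    rw [abs_le]
    constructor
    · simp only [hb]; omega
    · simp only [hb]; omega
  -- the identity `∑ a b = 4 ∑ ℓ r - 2 (L-1) ∑ r`
  have hid : ∑ ν ∈ range (K * L), a ν * b ν
      = 4 * ∑ ν ∈ range (K * L), ((ν / K : ℕ) : ℤ) * (r ν : ℤ)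
        - 2 * ((L : ℤ) - 1) * ∑ ν ∈ range (K * L), (r ν : ℤ) := by
    have h : ∀ ν ∈ range (K * L), a ν * b ν
        = (4 * (((ν / K : ℕ) : ℤ) * (r ν : ℤ)) - 2 * ((L : ℤ) - 1) * (r ν : ℤ))
          - ((R : ℤ) - 1) * a ν := by
      intro ν _
      simp only [ha, hb]
      ring
    rw [sum_congr rfl h, sum_sub_distrib, ← mul_sum, hsum_a, mul_zero, sub_zero, sum_sub_distrib,
      ← mul_sum, ← mul_sum]
  -- the bound `|∑ a b| ≤ (R-1) ∑ |a|`
  have hbound : |∑ ν ∈ range (K * L), a ν * b ν| ≤ ((R : ℤ) - 1) * ∑ ν ∈ range (K * L), |a ν| := by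
    calc |∑ ν ∈ range (K * L), a ν * b ν|
        ≤ ∑ ν ∈ range (K * L), |a ν * b ν| := abs_sum_le_sum_abs _ _
      _ = ∑ ν ∈ range (K * L), |a ν| * |b ν| := by simp_rw [abs_mul]
      _ ≤ ∑ ν ∈ range (K * L), |a ν| * ((R : ℤ) - 1) := by
          apply sum_le_sum
          intro ν hν
          exact mul_le_mul_of_nonneg_left (habs_b ν hν) (abs_nonneg _)
      _ = ((R : ℤ) - 1) * ∑ ν ∈ range (K * L), |a ν| := by rw [← sum_mul, mul_comm]
  have hrew : 8 * ∑ ν ∈ range (K * L), ((ν / K : ℕ) : ℤ) * (r ν : ℤ)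
        - 4 * ((L : ℤ) - 1) * ∑ ν ∈ range (K * L), (r ν : ℤ)
      = 2 * ∑ ν ∈ range (K * L), a ν * b ν := by
    rw [hid]; ring
  rw [hrew, abs_mul, abs_two]
  have hR' : (0 : ℤ) ≤ (R : ℤ) - 1 := by linarith
  calc 2 * |∑ ν ∈ range (K * L), a ν * b ν|
      ≤ 2 * (((R : ℤ) - 1) * ∑ ν ∈ range (K * L), |a ν|) := by linarith [hbound]
    _ = ((R : ℤ) - 1) * (2 * ∑ ν ∈ range (K * L), |a ν|) := by ring
    _ ≤ ((R : ℤ) - 1) * (K * (L : ℤ) ^ 2) := mul_le_mul_of_nonneg_left habs_a hR'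
    _ = ((R : ℤ) - 1) * K * (L : ℤ) ^ 2 := by ring

/-- **Lemma X** (Bugeaud–Laurent form, over `ℝ`).  With `N = KL`, `M = (L-1)/2 · ∑ r_ν` and
`G = N · L · (R-1) / 8` one has `M - G ≤ ∑_{ν<N} ⌊ν/K⌋ · r_ν ≤ M + G` for ANY integers
`r_ν ∈ [0, R-1]` — no distinctness or congruence hypothesis on the `r_ν`. -/
theorem soloInformed_lemmaX (K L R : ℕ) (r : ℕ → ℕ) (hr : ∀ ν < K * L, r ν < R) :
    ((L : ℝ) - 1) / 2 * (∑ ν ∈ range (K * L), (r ν : ℝ)) - (K : ℝ) * L * L * ((R : ℝ) - 1) / 8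
        ≤ ∑ ν ∈ range (K * L), ((ν / K : ℕ) : ℝ) * (r ν : ℝ) ∧
      ∑ ν ∈ range (K * L), ((ν / K : ℕ) : ℝ) * (r ν : ℝ)
        ≤ ((L : ℝ) - 1) / 2 * (∑ ν ∈ range (K * L), (r ν : ℝ))
          + (K : ℝ) * L * L * ((R : ℝ) - 1) / 8 := by
  have h := soloInformed_lemmaX_int K L R r hr
  have h' : |8 * ∑ ν ∈ range (K * L), ((ν / K : ℕ) : ℝ) * (r ν : ℝ)
      - 4 * ((L : ℝ) - 1) * ∑ ν ∈ range (K * L), (r ν : ℝ)| ≤ ((R : ℝ) - 1) * K * (L : ℝ) ^ 2 := by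
    have h'' := (Int.cast_le (R := ℝ)).mpr h
    push_cast at h''
    exact h''
  obtain ⟨h1, h2⟩ := abs_le.mp h'
  constructor
  · nlinarith [h1, h2]
  · nlinarith [h1, h2]

/-- The resulting Liouville constant: `G = N L (R-1)/8` gives `γ = 4G/(NLR) = (R-1)/(2R) < 1/2`
(Bugeaud–Laurent's normalisation `γ₁ = 4 G₁ / (N L R)`), for every `R ≥ 1`. -/
theorem soloInformed_lemmaX_gamma_lt_half (N L R : ℕ) (hN : 0 < N) (hL : 0 < L) (hR : 0 < R) :
    4 * ((N : ℝ) * L * ((R : ℝ) - 1) / 8) / ((N : ℝ) * L * R) < 1 / 2 := by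
  have hN' : (0 : ℝ) < N := by exact_mod_cast hN
  have hL' : (0 : ℝ) < L := by exact_mod_cast hL
  have hR' : (0 : ℝ) < R := by exact_mod_cast hR
  have hpos : (0 : ℝ) < (N : ℝ) * L * R := by positivity
  rw [div_lt_iff₀ hpos]
  nlinarith [mul_pos hN' hL']

end Summit.ABC.ABC.Theorems
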